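import Summits.AtomisticToContinuum.BoseEinsteinCondensation.Theses.BECDistantTilts
import Literature.MathematicalPhysics.QuantumManyBody.PeriodicBoseGasFracEnergy
import HarnessLib

/-!
# Strategist sketch (typed companion of STRATEGY-CENSUS.md) — crux `PeriodicBEC`
# (stmt-AtomisticToContinuum-8997), route-AtomisticToContinuum-BECDistantTilts

Every signature quoted in the census is a declaration of this file (or of the registered
skeleton `Cruxes/PeriodicBEC/Lines/birth.lean`, or of the sister crux's
`Cruxes/PeriodicIRBound/StrategistSketch{S1,P1}.lean`). Nothing here is filed as an item.
-/

noncomputable section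

namespace Summit.AtomisticToContinuum.BoseEinsteinCondensation.Cruxes.PeriodicBEC.Strategist

open MeasureTheory Filter
open scoped ENNReal Topology BigOperators
open Literature.MathematicalPhysics.QuantumManyBody.BoseGas
open Summit.AtomisticToContinuum.BoseEinsteinCondensation.Theses

/-! ## §D  The split children (verbatim the registered stubs of `Lines/birth.lean`) -/

/-- Child 1 of the UV/IR split: kinetic localisation of the depletion above the healing momentum
(= `stub_uvTail`; provable now). -/
def PeriodicUVTail : Prop :=
    ∀ v : ℝ → ENNReal, IsRepulsiveFiniteRange v →
      ∀ ε : ℝ, 0 < ε → ∃ κ : ℝ, 0 < κ ∧ ∃ ρ₀ : ℝ, 0 < ρ₀ ∧ ∀ ρ : ℝ, 0 < ρ → ρ < ρ₀ →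
        ∀ᶠ N : ℕ in Filter.atTop, ∃ δ : ENNReal, 0 < δ ∧
          ∀ Ψ : PeriodicTrialState N (sideLength ρ N),
            periodicEnergy v Ψ ≤ periodicGroundStateEnergy v N (sideLength ρ N) + δ →
              (∑' p : Fin 3 → ℤ,
                  if ENNReal.ofReal (κ ^ 2 * ρ) < fracDispersion 2 (sideLength ρ N) p then
                    cellOccupation N (sideLength ρ N) (planeWaveMode (sideLength ρ N) p) Ψ.ψ
                  else 0) ≤ ENNReal.ofReal (ε * N)

/-- Child 2 of the UV/IR split: no infrared catastrophe in the soft shell (= `stub_irShell`; the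
open heart). -/
def PeriodicIRShell : Prop :=
    ∀ v : ℝ → ENNReal, IsRepulsiveFiniteRange v →
      ∃ θ : ℝ, 0 ≤ θ ∧ θ < 1 ∧ ∀ κ : ℝ, 0 < κ → ∃ ρ₀ : ℝ, 0 < ρ₀ ∧ ∀ ρ : ℝ, 0 < ρ → ρ < ρ₀ →
        ∀ᶠ N : ℕ in Filter.atTop, ∃ δ : ENNReal, 0 < δ ∧
          ∀ Ψ : PeriodicTrialState N (sideLength ρ N),
            periodicEnergy v Ψ ≤ periodicGroundStateEnergy v N (sideLength ρ N) + δ →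
              (∑' p : Fin 3 → ℤ,
                  if p ≠ 0 ∧ fracDispersion 2 (sideLength ρ N) p ≤ ENNReal.ofReal (κ ^ 2 * ρ) then
                    cellOccupation N (sideLength ρ N) (planeWaveMode (sideLength ρ N) p) Ψ.ψ
                  else 0) ≤ ENNReal.ofReal (θ * N)

/-! ## §W  The `wuc` rung: quasi-condensation / thermodynamic-limit ODLRO of near-minimisers

Occupation of the momentum BALL `|2πp/L| ≤ 1/R` is `≥ cN` for EVERY fixed `R` (with `c`
independent of `R`): implied by the crux (the ball contains `p = 0`), unknown beyond the
Fournais/Junge scale `R ≲ (ρa)^{-1/2}(ρa³)^{-1/4-η}`, and strictly weaker than the crux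
(coherence may still die between `R` and `L`). -/

/-- Quasi-condensation (ODLRO in the thermodynamic limit, near-minimiser form). -/
def QuasiCondensation : Prop :=
    ∀ v : ℝ → ENNReal, IsRepulsiveFiniteRange v →
      ∃ ρ₀ : ℝ, 0 < ρ₀ ∧ ∀ ρ : ℝ, 0 < ρ → ρ < ρ₀ → ∃ c : ℝ, 0 < c ∧ ∀ R : ℝ, 0 < R →
        ∀ᶠ N : ℕ in Filter.atTop, ∃ δ : ENNReal, 0 < δ ∧
          ∀ Ψ : PeriodicTrialState N (sideLength ρ N),
            periodicEnergy v Ψ ≤ periodicGroundStateEnergy v N (sideLength ρ N) + δ →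
              ENNReal.ofReal (c * N) ≤
                ∑' p : Fin 3 → ℤ,
                  if fracDispersion 2 (sideLength ρ N) p ≤ ENNReal.ofReal (R⁻¹ ^ 2) then
                    cellOccupation N (sideLength ρ N) (planeWaveMode (sideLength ρ N) p) Ψ.ψ
                  else 0

/-- The crux implies quasi-condensation (the zero mode lies in every ball). -/
theorem quasiCondensation_of_periodicBEC (h : BECDistantTilts.PeriodicBEC) : QuasiCondensation := by
  intro v hv
  obtain ⟨ρ₀, hρ₀, H⟩ := h v hv
  refine ⟨ρ₀, hρ₀, fun ρ hρ hρlt => ?_⟩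
  obtain ⟨c, hc, Hc⟩ := H ρ hρ hρlt
  refine ⟨c, hc, fun R _hR => ?_⟩
  filter_upwards [Hc] with N hN
  obtain ⟨δ, hδ, hΨ⟩ := hN
  refine ⟨δ, hδ, fun Ψ hle => (hΨ Ψ hle).trans ?_⟩
  refine le_trans ?_ (ENNReal.le_tsum (0 : Fin 3 → ℤ))
  rw [if_pos]
  · rw [cellOccupation_planeWaveMode_zero]
  · rw [fracDispersion_zero two_ne_zero]; exact bot_le

/-- The missing converse rung, as a Prop: mesoscopic-to-macroscopic coherence ("coherence that is
alive at every fixed scale does not die between `R` and `L`"). With `quasiCondensation_of_periodicBEC`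
this is an equivalent re-packaging of the crux, NOT a weakening: recorded, not filed. -/
def MesoToMacro : Prop := QuasiCondensation → BECDistantTilts.PeriodicBEC

/-! ## §N  Negation: the shape of a counterexample -/

/-- `¬ PeriodicBEC` unfolded: an admissible `v` such that at arbitrarily small densities, for every
`c > 0`, frequently in `N`, ARBITRARILY-near minimisers with constant-mode occupation `< cN` exist —
i.e. (compactness at fixed `N, L`) a sequence of exact torus ground states without condensate. -/
theorem not_periodicBEC_iff :
    ¬ BECDistantTilts.PeriodicBEC ↔
      ∃ v : ℝ → ENNReal, IsRepulsiveFiniteRange v ∧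
        ∀ ρ₀ : ℝ, 0 < ρ₀ → ∃ ρ : ℝ, 0 < ρ ∧ ρ < ρ₀ ∧ ∀ c : ℝ, 0 < c →
          ∃ᶠ N : ℕ in Filter.atTop, ∀ δ : ENNReal, 0 < δ →
            ∃ Ψ : PeriodicTrialState N (sideLength ρ N),
              periodicEnergy v Ψ ≤ periodicGroundStateEnergy v N (sideLength ρ N) + δ ∧
                condensateOccupation N (sideLength ρ N) Ψ.ψ < ENNReal.ofReal (c * N) := by
  unfold BECDistantTilts.PeriodicBEC
  simp only [not_forall, not_exists, not_and, not_le, Filter.not_eventually, exists_prop]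

/-! ## §S  A strengthening with structure but no tool: pointwise-shell-free rate form

The weakest RATE form that block / RP-after-blocking mechanisms output (sister census §2.1,
`StrategistSketchP1.WindowSumIRBound`): the soft shell carries `≤ Cκ²√ρ·N`. It implies
`PeriodicIRShell` (take `θ := 1/2`, `ρ₀(κ) := (2Cκ²)^{-2}`); recorded for the ordering
`PeriodicIRBound (per-mode, 3972) ⇒ WindowSum (rate) ⇒ PeriodicIRShell (fraction) ⇐/⇒? crux`. -/

/-- Rate form of the infrared shell bound (Bogoliubov size `Nκ²√(ρa)`). -/
def WindowSumShell : Prop :=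
    ∀ v : ℝ → ENNReal, IsRepulsiveFiniteRange v →
      ∃ C : ℝ, 0 < C ∧ ∀ κ : ℝ, 0 < κ → ∃ ρ₀ : ℝ, 0 < ρ₀ ∧ ∀ ρ : ℝ, 0 < ρ → ρ < ρ₀ →
        ∀ᶠ N : ℕ in Filter.atTop, ∃ δ : ENNReal, 0 < δ ∧
          ∀ Ψ : PeriodicTrialState N (sideLength ρ N),
            periodicEnergy v Ψ ≤ periodicGroundStateEnergy v N (sideLength ρ N) + δ →
              (∑' p : Fin 3 → ℤ,
                  if p ≠ 0 ∧ fracDispersion 2 (sideLength ρ N) p ≤ ENNReal.ofReal (κ ^ 2 * ρ) then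
                    cellOccupation N (sideLength ρ N) (planeWaveMode (sideLength ρ N) p) Ψ.ψ
                  else 0) ≤ ENNReal.ofReal (C * κ ^ 2 * Real.sqrt ρ * N)

/-- The rate form implies the fraction form (`θ = 1/2`, density threshold shrunk to
`min ρ₀ (2Cκ²)^{-2}`). -/
theorem periodicIRShell_of_windowSumShell (h : WindowSumShell) : PeriodicIRShell := by
  intro v hv
  obtain ⟨C, hC, H⟩ := h v hv
  refine ⟨1 / 2, by norm_num, by norm_num, fun κ hκ => ?_⟩
  obtain ⟨ρ₀, hρ₀, Hρ⟩ := H κ hκ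
  have hCκ : 0 < 2 * C * κ ^ 2 := by positivity
  refine ⟨min ρ₀ ((2 * C * κ ^ 2)⁻¹ ^ 2), lt_min hρ₀ (by positivity), fun ρ hρ hρlt => ?_⟩
  have hρ1 : ρ < ρ₀ := lt_of_lt_of_le hρlt (min_le_left _ _)
  have hρ2 : ρ < (2 * C * κ ^ 2)⁻¹ ^ 2 := lt_of_lt_of_le hρlt (min_le_right _ _)
  filter_upwards [Hρ ρ hρ hρ1] with N hN
  obtain ⟨δ, hδ, hΨ⟩ := hN
  refine ⟨δ, hδ, fun Ψ hle => (hΨ Ψ hle).trans (ENNReal.ofReal_le_ofReal ?_)⟩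
  have hsqrt : Real.sqrt ρ < (2 * C * κ ^ 2)⁻¹ := by
    calc Real.sqrt ρ < Real.sqrt ((2 * C * κ ^ 2)⁻¹ ^ 2) :=
          Real.sqrt_lt_sqrt hρ.le hρ2
      _ = (2 * C * κ ^ 2)⁻¹ := Real.sqrt_sq (by positivity)
  have hkey : C * κ ^ 2 * Real.sqrt ρ ≤ 1 / 2 := by
    have h1 : C * κ ^ 2 * Real.sqrt ρ ≤ C * κ ^ 2 * (2 * C * κ ^ 2)⁻¹ :=
      mul_le_mul_of_nonneg_left hsqrt.le (by positivity)
    have h2 : C * κ ^ 2 * (2 * C * κ ^ 2)⁻¹ = 1 / 2 := by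
      field_simp
    linarith
  exact mul_le_mul_of_nonneg_right hkey (Nat.cast_nonneg N)

end Summit.AtomisticToContinuum.BoseEinsteinCondensation.Cruxes.PeriodicBEC.Strategist

end
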